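import Summits.QuantumFields.YangMills.Theorems.VirialFluxGapRingFrameDefs
import HarnessLib

/-!
# Route `VirialFluxGap` (YangMills): the INSERTION FORMULA for the derivative of the ring polynomial

Companion of ✓`VirialFluxGapRingFrameDefs` ∕ `VirialFluxGapRingDeficitFrameDerivative` (the `DF` package of the Euler-field hypothesis of
✓`EulerFieldReduction.periodicSoftness_of_eulerField`, item stmt-QuantumFields-24141).  There the frame derivative of the zero-flux deficit
is `D(ringPoly)(ringCoord P)[tangent]`; here `D(ringPoly)` is made EXPLICIT:

* §1 one-variable product rules for the three term shapes of `ringPoly` along a line `s ↦ M + sH` in the ambient matrix space: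
  temporal `2 − Re tr(A Bᴴ)`, seam `2 − Re tr(A (C D Eᴴ)ᴴ)`, plaquette `2 − Re tr(A B Cᴴ Dᴴ)` — the derivative is MINUS the sum of the
  INSERTIONS of `H` (one factor replaced by its tangent, conjugate transposes carried along);
* §2 ★★ `hasDerivAt_ringPoly_line` ∕ ★★ `fderiv_ringPoly_apply` — `D(ringPoly)(M)[H] = −(Σ_temporal Re tr(H M′ᴴ + M H′ᴴ)
  + Σ_seam Re tr(H_last S_eᴴ + M_last (H_x M₀ g′ᴴ + g_x H₀ g′ᴴ + g_x M₀ H′ᴴ)ᴴ) + Σ_plaquettes Re tr(H₁M₂M₃ᴴM₄ᴴ + M₁H₂M₃ᴴM₄ᴴ + M₁M₂H₃ᴴM₄ᴴ +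
  M₁M₂M₃ᴴH₄ᴴ))` (every ring history ∕ tangent; in particular `sliceFrameDeriv i e Y P` is this with `M = ringCoord P`, `H = sliceTangent P`);
(With `H` a frame tangent — supported on ONE variable — at most `2 + 4 + 4·4` insertions are non-zero, each `|Re tr(…)| ≤ 2·‖Y‖_F` on ring
histories; the explicit size bookkeeping is left to the consumer's chart.)

HONEST FRAMING: calculus bookkeeping; the coefficient field and the two pointwise inequalities of the Euler field are NOT here; ⟨24141⟩ stays OPEN;
the Yang–Mills mass gap is NOT proved; no summit is proved by a line.  THEOREMS ONLY (0 `def`, 0 `sorry`), standard axioms.  Width seat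
`ym-line-sfw-p2-w3` g58 (cell ym-idea-1, free hands), `--supports stmt-QuantumFields-24141`.
References: [cite: arXiv220412737, §2 (2.4) (p. 10)]; [cite: Luscher1983, §2].
-/

set_option autoImplicit false

noncomputable section

open scoped Matrix BigOperators ContDiff Topology
open Literature.MathematicalPhysics.QuantumFieldTheory hiding SU2
open Literature.MathematicalPhysics.QuantumLattice
open Literature.MathematicalPhysics.QuantumFieldTheory.SUNBakryEmery (matTop)

namespace Summit.QuantumFields.YangMills.Theorems.VirialFluxGap.FrameDerivative

open Summit.QuantumFields.YangMills.Theorems.FemtoTransferGap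

variable {L : ℕ} [NeZero L]

open scoped Matrix.Norms.Frobenius

attribute [local instance 2000] Literature.MathematicalPhysics.QuantumFieldTheory.SUNBakryEmery.matTop

/-! ## §1 One-variable product rules for the three term shapes -/

section Shapes

omit [NeZero L]

/-- `s ↦ (a s)ᴴ` is differentiable with derivative `(a′)ᴴ`. [folklore] -/
theorem hasDerivAt_conjTranspose {a : ℝ → Matrix (Fin 2) (Fin 2) ℂ} {a' : Matrix (Fin 2) (Fin 2) ℂ} {s : ℝ} (ha : HasDerivAt a a' s) :
    HasDerivAt (fun s => (a s)ᴴ) a'ᴴ s :=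
  ((LinearMap.toContinuousLinearMap conjT).hasFDerivAt.comp_hasDerivAt s ha)

/-- `s ↦ Re tr(a s)` is differentiable with derivative `Re tr a′`. [folklore] -/
theorem hasDerivAt_reTr {a : ℝ → Matrix (Fin 2) (Fin 2) ℂ} {a' : Matrix (Fin 2) (Fin 2) ℂ} {s : ℝ} (ha : HasDerivAt a a' s) :
    HasDerivAt (fun s => ((a s).trace).re) ((a'.trace).re) s :=
  ((LinearMap.toContinuousLinearMap reTr).hasFDerivAt.comp_hasDerivAt s ha)

/-- A coordinate line `s ↦ A + s·H` has derivative `H`. [folklore] -/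
theorem hasDerivAt_line (A H : Matrix (Fin 2) (Fin 2) ℂ) (s : ℝ) : HasDerivAt (fun s : ℝ => A + s • H) H s := by
  have h := ((hasDerivAt_id s).smul_const H).const_add A
  simpa using h

/-- ★ Temporal shape: `d/ds|₀ [2 − Re tr((A+sH)(B+sK)ᴴ)] = −Re tr(H Bᴴ + A Kᴴ)`. [folklore] -/
theorem hasDerivAt_temporalShape (A H B K : Matrix (Fin 2) (Fin 2) ℂ) :
    HasDerivAt (fun s : ℝ => (2 : ℝ) - (((A + s • H) * (B + s • K)ᴴ).trace).re) (-((H * Bᴴ + A * Kᴴ).trace).re) 0 := by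
  have h1 := hasDerivAt_line A H 0
  have h2 := hasDerivAt_conjTranspose (hasDerivAt_line B K 0)
  have h := hasDerivAt_reTr (h1.fun_mul h2)
  simp only [zero_smul, add_zero] at h
  exact h.const_sub (2 : ℝ)

/-- ★ Seam shape: `d/ds|₀ [2 − Re tr((A+sH)((C+sP)(D+sQ)(E+sR)ᴴ)ᴴ)] = −Re tr(H (C D Eᴴ)ᴴ + A (P D Eᴴ + C Q Eᴴ + C D Rᴴ)ᴴ)`. [folklore] -/
theorem hasDerivAt_seamShape (A H C P D Q E R : Matrix (Fin 2) (Fin 2) ℂ) :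
    HasDerivAt (fun s : ℝ => (2 : ℝ) - (((A + s • H) * ((C + s • P) * (D + s • Q) * (E + s • R)ᴴ)ᴴ).trace).re)
      (-((H * (C * D * Eᴴ)ᴴ + A * (P * D * Eᴴ + C * Q * Eᴴ + C * D * Rᴴ)ᴴ).trace).re) 0 := by
  have hA := hasDerivAt_line A H 0
  have hC := hasDerivAt_line C P 0
  have hD := hasDerivAt_line D Q 0
  have hE := hasDerivAt_conjTranspose (hasDerivAt_line E R 0)
  have hin := hasDerivAt_conjTranspose ((hC.fun_mul hD).fun_mul hE)
  have h := hasDerivAt_reTr (hA.fun_mul hin)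
  simp only [zero_smul, add_zero] at h
  exact (h.const_sub (2 : ℝ)).congr_deriv (by rw [Matrix.add_mul])

/-- ★ Plaquette shape: `d/ds|₀ [2 − Re tr((A+sH)(B+sK)(C+sP)ᴴ(D+sQ)ᴴ)] = −Re tr(H B Cᴴ Dᴴ + A K Cᴴ Dᴴ + A B Pᴴ Dᴴ + A B Cᴴ Qᴴ)`. [folklore] -/
theorem hasDerivAt_plaquetteShape (A H B K C P D Q : Matrix (Fin 2) (Fin 2) ℂ) :
    HasDerivAt (fun s : ℝ => (2 : ℝ) - (((A + s • H) * (B + s • K) * (C + s • P)ᴴ * (D + s • Q)ᴴ).trace).re)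
      (-((H * B * Cᴴ * Dᴴ + A * K * Cᴴ * Dᴴ + A * B * Pᴴ * Dᴴ + A * B * Cᴴ * Qᴴ).trace).re) 0 := by
  have hA := hasDerivAt_line A H 0
  have hB := hasDerivAt_line B K 0
  have hC := hasDerivAt_conjTranspose (hasDerivAt_line C P 0)
  have hD := hasDerivAt_conjTranspose (hasDerivAt_line D Q 0)
  have h := hasDerivAt_reTr (((hA.fun_mul hB).fun_mul hC).fun_mul hD)
  simp only [zero_smul, add_zero] at h
  exact (h.const_sub (2 : ℝ)).congr_deriv (by simp only [Matrix.add_mul])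

end Shapes

/-! ## §2 The insertion formula for `D(ringPoly)` -/

/-- ★★ **Line derivative of the ring polynomial = minus the sum of insertions.** [cite: arXiv220412737, §2 (2.4) (p. 10)] -/
theorem hasDerivAt_ringPoly_line
    (M H : (Fin (2 * L - 1 + 1) → Edge 3 L → Matrix (Fin 2) (Fin 2) ℂ) × (Site 3 L → Matrix (Fin 2) (Fin 2) ℂ)) :
    HasDerivAt (fun s : ℝ => ringPoly L (M + s • H))
      (-((∑ i : Fin (2 * L - 1), ∑ e : Edge 3 L,
            ((H.1 i.castSucc e * (M.1 i.succ e)ᴴ + M.1 i.castSucc e * (H.1 i.succ e)ᴴ).trace).re) +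
         (∑ e : Edge 3 L,
            ((H.1 (Fin.last (2 * L - 1)) e * (M.2 e.1 * M.1 0 e * (M.2 (e.1.shift e.2))ᴴ)ᴴ +
              M.1 (Fin.last (2 * L - 1)) e * (H.2 e.1 * M.1 0 e * (M.2 (e.1.shift e.2))ᴴ + M.2 e.1 * H.1 0 e * (M.2 (e.1.shift e.2))ᴴ +
                M.2 e.1 * M.1 0 e * (H.2 (e.1.shift e.2))ᴴ)ᴴ).trace).re) +
         ∑ j : Fin (2 * L - 1 + 1), ∑ p : Plaquette 3 L,
            ((H.1 j (p.1, p.2.1.1) * M.1 j (p.1.shift p.2.1.1, p.2.1.2) * (M.1 j (p.1.shift p.2.1.2, p.2.1.1))ᴴ * (M.1 j (p.1, p.2.1.2))ᴴ +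
              M.1 j (p.1, p.2.1.1) * H.1 j (p.1.shift p.2.1.1, p.2.1.2) * (M.1 j (p.1.shift p.2.1.2, p.2.1.1))ᴴ * (M.1 j (p.1, p.2.1.2))ᴴ +
              M.1 j (p.1, p.2.1.1) * M.1 j (p.1.shift p.2.1.1, p.2.1.2) * (H.1 j (p.1.shift p.2.1.2, p.2.1.1))ᴴ * (M.1 j (p.1, p.2.1.2))ᴴ +
              M.1 j (p.1, p.2.1.1) * M.1 j (p.1.shift p.2.1.1, p.2.1.2) * (M.1 j (p.1.shift p.2.1.2, p.2.1.1))ᴴ * (H.1 j (p.1, p.2.1.2))ᴴ).trace).re)) 0 := by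
  unfold ringPoly
  simp only [Prod.fst_add, Prod.snd_add, Prod.smul_fst, Prod.smul_snd, Pi.add_apply, Pi.smul_apply]
  have h1 : HasDerivAt (fun s : ℝ => ∑ i : Fin (2 * L - 1), ∑ e : Edge 3 L,
      ((2 : ℝ) - (((M.1 i.castSucc e + s • H.1 i.castSucc e) * (M.1 i.succ e + s • H.1 i.succ e)ᴴ).trace).re))
      (∑ i : Fin (2 * L - 1), ∑ e : Edge 3 L, -((H.1 i.castSucc e * (M.1 i.succ e)ᴴ + M.1 i.castSucc e * (H.1 i.succ e)ᴴ).trace).re) 0 :=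
    HasDerivAt.fun_sum fun i _ => HasDerivAt.fun_sum fun e _ => hasDerivAt_temporalShape _ _ _ _
  have h2 : HasDerivAt (fun s : ℝ => ∑ e : Edge 3 L,
      ((2 : ℝ) - (((M.1 (Fin.last (2 * L - 1)) e + s • H.1 (Fin.last (2 * L - 1)) e) *
        ((M.2 e.1 + s • H.2 e.1) * (M.1 0 e + s • H.1 0 e) * (M.2 (e.1.shift e.2) + s • H.2 (e.1.shift e.2))ᴴ)ᴴ).trace).re))
      (∑ e : Edge 3 L, -((H.1 (Fin.last (2 * L - 1)) e * (M.2 e.1 * M.1 0 e * (M.2 (e.1.shift e.2))ᴴ)ᴴ +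
        M.1 (Fin.last (2 * L - 1)) e * (H.2 e.1 * M.1 0 e * (M.2 (e.1.shift e.2))ᴴ + M.2 e.1 * H.1 0 e * (M.2 (e.1.shift e.2))ᴴ +
          M.2 e.1 * M.1 0 e * (H.2 (e.1.shift e.2))ᴴ)ᴴ).trace).re) 0 :=
    HasDerivAt.fun_sum fun e _ => hasDerivAt_seamShape _ _ _ _ _ _ _ _
  have h3 : HasDerivAt (fun s : ℝ => ∑ j : Fin (2 * L - 1 + 1), ∑ p : Plaquette 3 L,
      ((2 : ℝ) - (((M.1 j (p.1, p.2.1.1) + s • H.1 j (p.1, p.2.1.1)) * (M.1 j (p.1.shift p.2.1.1, p.2.1.2) + s • H.1 j (p.1.shift p.2.1.1, p.2.1.2)) *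
        (M.1 j (p.1.shift p.2.1.2, p.2.1.1) + s • H.1 j (p.1.shift p.2.1.2, p.2.1.1))ᴴ * (M.1 j (p.1, p.2.1.2) + s • H.1 j (p.1, p.2.1.2))ᴴ).trace).re))
      (∑ j : Fin (2 * L - 1 + 1), ∑ p : Plaquette 3 L,
        -((H.1 j (p.1, p.2.1.1) * M.1 j (p.1.shift p.2.1.1, p.2.1.2) * (M.1 j (p.1.shift p.2.1.2, p.2.1.1))ᴴ * (M.1 j (p.1, p.2.1.2))ᴴ +
          M.1 j (p.1, p.2.1.1) * H.1 j (p.1.shift p.2.1.1, p.2.1.2) * (M.1 j (p.1.shift p.2.1.2, p.2.1.1))ᴴ * (M.1 j (p.1, p.2.1.2))ᴴ +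
          M.1 j (p.1, p.2.1.1) * M.1 j (p.1.shift p.2.1.1, p.2.1.2) * (H.1 j (p.1.shift p.2.1.2, p.2.1.1))ᴴ * (M.1 j (p.1, p.2.1.2))ᴴ +
          M.1 j (p.1, p.2.1.1) * M.1 j (p.1.shift p.2.1.1, p.2.1.2) * (M.1 j (p.1.shift p.2.1.2, p.2.1.1))ᴴ * (H.1 j (p.1, p.2.1.2))ᴴ).trace).re) 0 :=
    HasDerivAt.fun_sum fun j _ => HasDerivAt.fun_sum fun p _ => hasDerivAt_plaquetteShape _ _ _ _ _ _ _ _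
  refine ((h1.add h2).add h3).congr_deriv ?_
  simp only [Finset.sum_neg_distrib]
  ring

/-- ★★ **The insertion formula for `D(ringPoly)`.**  For every point `M` and tangent `H` of the ambient matrix space,
`D(ringPoly)(M)[H]` is minus the sum over the terms of `ringPoly` of the insertions of `H`; with `M = ringCoord P`, `H = sliceTangent i e Y P`
this is `sliceFrameDeriv i e Y P` (the tangent is supported on ONE variable, so at most `2 + 1 + 4` insertions are non-zero).
[cite: arXiv220412737, §2 (2.4) (p. 10)] -/
theorem fderiv_ringPoly_apply
    (M H : (Fin (2 * L - 1 + 1) → Edge 3 L → Matrix (Fin 2) (Fin 2) ℂ) × (Site 3 L → Matrix (Fin 2) (Fin 2) ℂ)) :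
    fderiv ℝ (ringPoly L) M H =
      -((∑ i : Fin (2 * L - 1), ∑ e : Edge 3 L,
            ((H.1 i.castSucc e * (M.1 i.succ e)ᴴ + M.1 i.castSucc e * (H.1 i.succ e)ᴴ).trace).re) +
         (∑ e : Edge 3 L,
            ((H.1 (Fin.last (2 * L - 1)) e * (M.2 e.1 * M.1 0 e * (M.2 (e.1.shift e.2))ᴴ)ᴴ +
              M.1 (Fin.last (2 * L - 1)) e * (H.2 e.1 * M.1 0 e * (M.2 (e.1.shift e.2))ᴴ + M.2 e.1 * H.1 0 e * (M.2 (e.1.shift e.2))ᴴ +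
                M.2 e.1 * M.1 0 e * (H.2 (e.1.shift e.2))ᴴ)ᴴ).trace).re) +
         ∑ j : Fin (2 * L - 1 + 1), ∑ p : Plaquette 3 L,
            ((H.1 j (p.1, p.2.1.1) * M.1 j (p.1.shift p.2.1.1, p.2.1.2) * (M.1 j (p.1.shift p.2.1.2, p.2.1.1))ᴴ * (M.1 j (p.1, p.2.1.2))ᴴ +
              M.1 j (p.1, p.2.1.1) * H.1 j (p.1.shift p.2.1.1, p.2.1.2) * (M.1 j (p.1.shift p.2.1.2, p.2.1.1))ᴴ * (M.1 j (p.1, p.2.1.2))ᴴ +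
              M.1 j (p.1, p.2.1.1) * M.1 j (p.1.shift p.2.1.1, p.2.1.2) * (H.1 j (p.1.shift p.2.1.2, p.2.1.1))ᴴ * (M.1 j (p.1, p.2.1.2))ᴴ +
              M.1 j (p.1, p.2.1.1) * M.1 j (p.1.shift p.2.1.1, p.2.1.2) * (M.1 j (p.1.shift p.2.1.2, p.2.1.1))ᴴ * (H.1 j (p.1, p.2.1.2))ᴴ).trace).re) := by
  -- the line derivative of a differentiable function is the Fréchet derivative applied to the direction
  have hline : HasDerivAt (fun s : ℝ => M + s • H) H 0 := by
    have h := ((hasDerivAt_id (0 : ℝ)).smul_const H).const_add M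
    simpa using h
  have hd : DifferentiableAt ℝ (ringPoly L) (M + (0 : ℝ) • H) := (contDiff_ringPoly (L := L)).differentiable (by simp) _
  have hchain := hd.hasFDerivAt.comp_hasDerivAt (0 : ℝ) hline
  rw [zero_smul, add_zero] at hchain
  exact hchain.unique (hasDerivAt_ringPoly_line M H)

end Summit.QuantumFields.YangMills.Theorems.VirialFluxGap.FrameDerivative

end
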